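/-
Copyright (c) 2026. All rights reserved.
Released under Apache 2.0 license as described in the file LICENSE.
-/
import Literature.NumberTheory.GaloisRepresentations.LocalDualityTwoZeroInputs
import Literature.NumberTheory.GaloisRepresentations.CorNaturality
import Literature.NumberTheory.GaloisRepresentations.ArtinFormalism
import Literature.NumberTheory.GaloisRepresentations.LocalFieldCdTwo
import HarnessLib

/-!
# Local Tate duality in bidegree `(2, 0)`: `|H²(F, M)| = |Hom_{Γ_F}(M, μ)|`

For a non-archimedean local field `F` of characteristic `0`, a prime `p` and a finite discrete
`Γ_F`-module `M` killed by `p^k` we prove (Serre, *Cohomologie galoisienne*, II §5.2 Thm. 2, `i = 2`;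
Milne, *ADT* I Cor. 2.3: `H²(F, M) ≅ H⁰(F, M^D)^*`):

  `H²(F, M)` is finite and `|H²(F, M)| = |(M^D)^{Γ_F}|`,  `M^D = Hom(M, μ_{p^k})`
  (`natCard_two_eq_natCard_invariants_homRep`).

Proof.  Let `n = p^k`, `Ω = μ_n`, `ι_F : H²(F, μ_n) ↪ ℤ/n` (`exists_injective_iota_top`).  Choose
`E/F` finite with `p ∤ [E:F]` such that `Gal(F̄/E)` acts on `M × μ_n` through a finite `p`-group
(`exists_subgroup_index_coprime_isPGroup` for `M × μ_n`); then `μ_p` is fixed by `Gal(F̄/E)`, and with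
`ι_E = ι_F ∘ cor` (injective on the `p`-group `H²(E, μ_n)`, `eq_zero_of_cor_two_mu_eq_zero`) the
dévissages over `Gal(F̄/E)` (`TateDualityZeroTwoLeft`, `TateDualityTwoZeroSurj`, inputs
`LocalDualityTwoZeroInputs`) give: `H²(E, M)` finite; every additive `H²(E, M) → ℤ/n` is
`⟨·, f'⟩_E`; and the left kernel of `(M^D)^{Gal(F̄/E)} × H²(E, M^{DD}) → ℤ/n` is trivial.  Descent:
* `H²(F, M) ↪ H²(E, M)` (`cor ∘ res = [E:F]`, `p ∤ [E:F]`), so `H²(F, M)` is finite;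
* (`≤`) for `λ : H²(F, M) → ℤ/n`, `λ ∘ cor = ⟨·, f'⟩_E` and the **projection formula**
  `cor(H²(ev_{f'})(res z)) = H²(N ev_{f'}) z` (`cor_cohomologyMap_resH`) give
  `⟨·, N f'⟩_F = [E:F] λ`, whence `λ = ⟨·, c N f'⟩_F` (`c [E:F] ≡ 1 mod n`): so
  `|H²(F, M)| = |Hom(H²(F, M), ℤ/n)| ≤ |(M^D)^{Γ_F}|`;
* (`≥`) a `Γ_F`-invariant `w ∈ M^D` pairing to zero with `H²(F, M^{DD})` pairs to zero with
  `H²(E, M^{DD})` (naturality of `cor`, `cor_cohomologyMap`), hence vanishes: so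
  `|(M^D)^{Γ_F}| ≤ |H²(F, M^{DD})| = |H²(F, M)|` (`biDualIso`).

## References
* J.-P. Serre, *Galois Cohomology*, Springer, 1997, II §5.2 Thm. 2. [SerreGaloisCohomology1997]
* J. S. Milne, *Arithmetic Duality Theorems*, 2006, I Cor. 2.3. [MilneADT2006]
-/

noncomputable section

open CategoryTheory Function
open Field IsNonarchimedeanLocalField ValuativeRel IntermediateField

universe u

namespace Literature.NumberTheory.GaloisRepresentations

open _root_.TopRep _root_.ContRepresentation _root_.ContinuousCohomology DiscreteGaloisModule
open LocalWeilDatum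

namespace ContinuousRep

section ZeroTwoSub

variable {G : Type u} [Group G] [TopologicalSpace G] [IsTopologicalGroup G] [LocallyCompactSpace G]
variable {Ω : Type u} [AddCommGroup Ω] [TopologicalSpace Ω] [DiscreteTopology Ω] {n : ℕ}
variable {M : Type u} [AddCommGroup M] [TopologicalSpace M] [DiscreteTopology M] [Finite M]

/-- `zeroTwo` is subtractive in the invariant element. [folklore] -/
theorem zeroTwo_sub (ρ : ContinuousRep G ℤ M) (ω : ContinuousRep G ℤ Ω)
    (ι : continuousCohomology 2 ω.toTopRep →+ ZMod n) (w w' : M) (hw : ∀ g : G, ρ g w = w)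
    (hw' : ∀ g : G, ρ g w' = w') (hww : ∀ g : G, ρ g (w - w') = w - w')
    (z : continuousCohomology 2 (ρ.homRep ω).toTopRep) :
    ρ.zeroTwo ω ι (w - w') hww z = ρ.zeroTwo ω ι w hw z - ρ.zeroTwo ω ι w' hw' z := by
  obtain ⟨c, rfl⟩ := twoCocycleClass_surjective _ z
  rw [zeroTwo_apply, zeroTwo_apply, zeroTwo_apply, cohomologyMap_twoCocycleClass,
    cohomologyMap_twoCocycleClass, cohomologyMap_twoCocycleClass, ← map_sub, ← twoCocycleClass_sub]
  congr 2
  refine Subtype.ext (ContinuousMap.ext fun q => ?_)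
  obtain ⟨σ, τ⟩ := q
  change (ρ.evalPairing ω).toLin (w - w') (c.1 (σ, τ)) =
    (ρ.evalPairing ω).toLin w (c.1 (σ, τ)) - (ρ.evalPairing ω).toLin w' (c.1 (σ, τ))
  rw [LinearMap.map_sub₂]

end ZeroTwoSub

end ContinuousRep

section Local

variable (F : Type u) [Field F] [ValuativeRel F] [TopologicalSpace F] [IsNonarchimedeanLocalField F] [CharZero F]
variable {M : Type u} [AddCommGroup M] [TopologicalSpace M] [DiscreteTopology M] [Finite M]

attribute [local instance] compactSpace_of_isClosed_subgroup isClosed_galFixing' finite_quot_galFixing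
  Fintype.ofFinite finite_muCarrier

/-- **Local Tate duality in bidegree `(2, 0)`, numerically**: for a non-archimedean local field `F` of
characteristic `0` and a finite discrete `Γ_F`-module `M` killed by `p^k` (`p` prime), `H²(F, M)` is
finite and `|H²(F, M)| = |Hom_{Γ_F}(M, μ_{p^k})|` (`= |H⁰(F, M^D)|`).  See the module docstring.
[cite: SerreGaloisCohomology1997, II §5.2 Thm. 2] [cite: MilneADT2006, I Cor. 2.3] -/
theorem natCard_two_eq_natCard_invariants_homRep {p k : ℕ} [hp : Fact p.Prime]
    (ρ : ContinuousRep (absoluteGaloisGroup F) ℤ M) (hM : ∀ m : M, p ^ k • m = 0) :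
    Finite (continuousCohomology 2 ρ.toTopRep) ∧
      Nat.card (continuousCohomology 2 ρ.toTopRep) =
        Nat.card (ρ.homRep (mu F (p ^ k))).toTopRep.ρ.invariants := by
  classical
  haveI := absoluteGaloisGroup_compactSpace F
  haveI : NeZero (p ^ k) := ⟨pow_ne_zero k hp.out.ne_zero⟩
  have eΩ := muEquivZMod F (p ^ k)
  have hpM : IsPrimaryTorsion p M := fun m => ⟨k, hM m⟩
  -- the trivial module
  by_cases hsub : Subsingleton M
  · haveI := subsingleton_continuousCohomology_of_subsingleton ρ.toTopRep 1
    haveI : Subsingleton (HomCarrier M (MuCarrier F (p ^ k))) :=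
      ⟨fun f g => HomCarrier.ext fun m => by rw [Subsingleton.elim m 0, map_zero, map_zero]⟩
    refine ⟨Finite.of_subsingleton, ?_⟩
    rw [Nat.card_of_subsingleton (0 : continuousCohomology 2 ρ.toTopRep),
      Nat.card_of_subsingleton (0 : (ρ.homRep (mu F (p ^ k))).toTopRep.ρ.invariants)]
  haveI : Nontrivial M := not_subsingleton_iff_nontrivial.1 hsub
  have hk : k ≠ 0 := by
    rintro rfl
    obtain ⟨m, hm⟩ := exists_ne (0 : M)
    exact hm (by simpa using hM m)
  have hpn : p ∣ p ^ k := dvd_pow_self p hk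
  -- `E/F`: a Sylow `p`-subgroup of the image of `Γ_F` on `M × μ_n`
  obtain ⟨S', hopen, hidx, N₀, hN₀, hfin, hP, htriv⟩ := exists_subgroup_index_coprime_isPGroup (ρ.prod (mu F (p ^ k))) p
  obtain ⟨E, hEfin, hE⟩ := exists_galFixing_eq_of_isOpen S' hopen
  subst hE
  haveI := hEfin
  haveI := hN₀
  haveI := hfin
  have hN₀M : ∀ g ∈ N₀, ∀ m : M, ρ (g : absoluteGaloisGroup F) m = m := fun g hg m =>
    congrArg Prod.fst (htriv g hg (m, 0))
  have hN₀Ω : ∀ g ∈ N₀, ∀ v : MuCarrier F (p ^ k), mu F (p ^ k) (g : absoluteGaloisGroup F) v = v := fun g hg v =>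
    congrArg Prod.snd (htriv g hg (0, v))
  -- `μ_p` is fixed by `Gal(F̄/E)`
  have hμ : ∀ (g : galFixing F E) (v : MuCarrier F p), mu F p (g : absoluteGaloisGroup F) v = v := by
    have hinj : Injective (muInclusion F hpn) := fun a b h =>
      muVal_injective F p (by rw [← muVal_muInclusion F hpn a, h, muVal_muInclusion])
    have hN₀p : ∀ g ∈ N₀, ∀ v : MuCarrier F p, (mu F p).restrict (subgroupIncl (galFixing F E)) g v = v :=
      fun g hg v => hinj ((TopRep.hom_comm_apply (muInclHom F hpn) (g : absoluteGaloisGroup F) v).trans (hN₀Ω g hg _))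
    have hprim : IsPrimaryTorsion p (MuCarrier F p) := fun v =>
      ⟨1, muVal_injective F p (by rw [pow_one, muVal_nsmul, muVal_pow_eq_one, muVal_zero])⟩
    have hcardp : Nat.card (MuCarrier F p) = p := (Nat.card_congr (muEquivZMod F p).toEquiv).trans (Nat.card_zmod p)
    haveI : Nontrivial (MuCarrier F p) := Finite.one_lt_card_iff_nontrivial.1 (by rw [hcardp]; exact hp.out.one_lt)
    obtain ⟨b, hb0, hb⟩ := exists_ne_zero_forall_apply_eq N₀ hP ((mu F p).restrict (subgroupIncl (galFixing F E))) hprim hN₀p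
    intro g v
    obtain ⟨c, rfl⟩ := AddSubgroup.mem_zmultiples_iff.1 (ContinuousRep.forall_mem_zmultiples_of_card hcardp hb0 v)
    rw [map_zsmul]
    exact congrArg (c • ·) (hb g)
  -- `ι_F` and `ι_E = ι_F ∘ cor`
  obtain ⟨ιF, hιF⟩ := exists_injective_iota_top F (p ^ k)
  let ιE : continuousCohomology 2 ((mu F (p ^ k)).restrict (subgroupIncl (galFixing F E))).toTopRep →+ ZMod (p ^ k) :=
    ιF.comp (cor (galFixing F E) (mu F (p ^ k)) 2).hom.toLinearMap.toAddMonoidHom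
  have hιE_apply : ∀ z, ιE z = ιF (cor (galFixing F E) (mu F (p ^ k)) 2 z) := fun _ => rfl
  have hιE : Injective ιE := by
    refine (injective_iff_map_eq_zero _).2 fun z hz => ?_
    have hcor : cor (galFixing F E) (mu F (p ^ k)) 2 z = 0 := (injective_iff_map_eq_zero ιF).1 hιF _ hz
    exact eq_zero_of_cor_two_mu_eq_zero F E hp.out hidx z ⟨k, nsmul_two_mu_eq_zero F (galFixing F E) (p ^ k) z⟩ hcor
  -- the line inputs over `Gal(F̄/E)` and `cd_p ≤ 2`
  have hlineLeft : ∀ (W : Type u) [AddCommGroup W] [TopologicalSpace W] [DiscreteTopology W] [Finite W]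
      (τ : ContinuousRep (galFixing F E) ℤ W) (hτ : ∀ (g : galFixing F E) (w : W), τ g w = w), Nat.card W = p →
      ∀ w : W, (∀ z, τ.zeroTwo ((mu F (p ^ k)).restrict (subgroupIncl (galFixing F E))) ιE w (hτ · w) z = 0) → w = 0 :=
    fun W _ _ _ _ τ hτ hW w hz => zeroTwo_left_line F E hpn τ hτ hW ιE hιE w hz
  have hlineSurj := fun (W : Type u) [AddCommGroup W] [TopologicalSpace W] [DiscreteTopology W] [Finite W]
      (τ : ContinuousRep (galFixing F E) ℤ W) (hτ : ∀ (g : galFixing F E) (w : W), τ g w = w) (hW : Nat.card W = p)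
      (μ' : continuousCohomology 2 τ.toTopRep →+ ZMod (p ^ k)) => twoZero_surjective_line F E hpn hμ τ hτ hW ιE hιE μ'
  have h11r := fun (W : Type u) [AddCommGroup W] [TopologicalSpace W] [DiscreteTopology W] [Finite W]
      (τ : ContinuousRep (galFixing F E) ℤ W) (hτ : ∀ (g : galFixing F E) (w : W), τ g w = w) (hW : Nat.card W = p)
      (b : continuousCohomology 1 (τ.homRep ((mu F (p ^ k)).restrict (subgroupIncl (galFixing F E)))).toTopRep) hb =>
    dualityPairing_right_line F E hpn hμ τ hτ hW ιE hιE b hb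
  have h3 : ∀ (X : Type u) [AddCommGroup X] [TopologicalSpace X] [DiscreteTopology X] [Finite X]
      (τ : ContinuousRep (galFixing F E) ℤ X), IsPrimaryTorsion p X → (∀ g ∈ N₀, ∀ x : X, τ g x = x) →
      Subsingleton (continuousCohomology 3 (τ.homRep ((mu F (p ^ k)).restrict (subgroupIncl (galFixing F E)))).toTopRep) :=
    fun X _ _ _ _ τ hX _ => subsingleton_continuousCohomology_galFixing_of_two_lt F E _ (isPrimaryTorsion_homCarrier hX) (by norm_num)
  have h3' : ∀ (X : Type u) [AddCommGroup X] [TopologicalSpace X] [DiscreteTopology X] [Finite X]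
      (τ : ContinuousRep (galFixing F E) ℤ X), IsPrimaryTorsion p X → (∀ g ∈ N₀, ∀ x : X, τ g x = x) →
      Subsingleton (continuousCohomology 3 τ.toTopRep) :=
    fun X _ _ _ _ τ hX _ => subsingleton_continuousCohomology_galFixing_of_two_lt F E τ hX (by norm_num)
  -- over `E`
  have hN₀E : ∀ g ∈ N₀, ∀ m : M, ρ.restrict (subgroupIncl (galFixing F E)) g m = m := hN₀M
  have finE : Finite (continuousCohomology 2 (ρ.restrict (subgroupIncl (galFixing F E))).toTopRep) :=
    ContinuousRep.finite_two_of_devissage N₀ hP (fun W _ _ _ _ τ hτ hW => (natCard_two_line F E hμ τ hτ hW).1) M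
      (ρ.restrict (subgroupIncl (galFixing F E))) hpM hN₀E
  -- `H²(F, M) ↪ H²(E, M)`, finiteness
  have hH2n : ∀ z : continuousCohomology 2 ρ.toTopRep, (p ^ k) • z = 0 :=
    nsmul_continuousCohomology_two_eq_zero ρ.toTopRep (p ^ k) hM
  have hres : Injective (resH (galFixing F E) ρ 2) := (injective_iff_map_eq_zero _).2 fun z hz => by
    have h1 : (galFixing F E).index • z = 0 := by rw [← cor_resH (galFixing F E) ρ 1 z, hz, map_zero]
    exact eq_zero_of_nsmul_of_pow_nsmul hp.out hidx h1 (hH2n z)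
  haveI finF : Finite (continuousCohomology 2 ρ.toTopRep) := Finite.of_injective _ hres
  -- (≤) surjectivity of `f ↦ ⟨·, f⟩_F` onto `Hom(H²(F, M), ℤ/n)`
  have surjE := ContinuousRep.twoZero_surjective_of_devissage ((mu F (p ^ k)).restrict (subgroupIncl (galFixing F E)))
    eΩ ιE N₀ hP hlineSurj h11r h3' M (ρ.restrict (subgroupIncl (galFixing F E))) hpM hM hN₀E
  obtain ⟨c, hc⟩ : ∃ c : ℤ, ∀ x : ZMod (p ^ k), (c * (galFixing F E).index) • x = x := by
    have hcop : Nat.Coprime (galFixing F E).index (p ^ k) :=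
      Nat.Coprime.pow_right k ((Nat.Prime.coprime_iff_not_dvd hp.out).2 hidx).symm
    obtain ⟨a, b, hab⟩ := Nat.isCoprime_iff_coprime.2 hcop
    refine ⟨a, fun x => ?_⟩
    have h1 : ((a * (galFixing F E).index : ℤ) : ZMod (p ^ k)) = 1 := by
      have h := congrArg (fun t : ℤ => (t : ZMod (p ^ k))) hab
      have hpk : ((p : ZMod (p ^ k)) ^ k) = 0 := by rw [← Nat.cast_pow, ZMod.natCast_self]
      push_cast at h ⊢
      rw [hpk, mul_zero, add_zero] at h
      exact h
    rw [zsmul_eq_mul, h1, one_mul]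
  have surjF : ∀ lam : continuousCohomology 2 ρ.toTopRep →+ ZMod (p ^ k),
      ∃ (f : HomCarrier M (MuCarrier F (p ^ k))) (hf : ∀ g, ρ.homRep (mu F (p ^ k)) g f = f),
        ρ.twoZero (mu F (p ^ k)) ιF f hf = lam := by
    intro lam
    obtain ⟨f', hf', hsurj⟩ := surjE (lam.comp (cor (galFixing F E) ρ 2).hom.toLinearMap.toAddMonoidHom)
    let φ := ((ρ.restrict (subgroupIncl (galFixing F E))).evalPairing
      ((mu F (p ^ k)).restrict (subgroupIncl (galFixing F E)))).flip.leftHom f' hf'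
    let Nφ := normHom (galFixing F E) φ
    let fN : HomCarrier M (MuCarrier F (p ^ k)) := HomCarrier.ofAddMonoidHom Nφ.hom.toLinearMap.toAddMonoidHom
    have hfN : ∀ g, ρ.homRep (mu F (p ^ k)) g fN = fN := fun g =>
      (ContinuousRep.homRep_apply_eq_self_iff _ _ g fN).2 fun m => (TopRep.hom_comm_apply Nφ g m).symm
    have key : ∀ z, ρ.twoZero (mu F (p ^ k)) ιF fN hfN z = (galFixing F E).index • lam z := by
      intro z
      have e1 : ρ.twoZero (mu F (p ^ k)) ιF fN hfN z = ιF (cohomologyMap Nφ 2 z) := by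
        obtain ⟨x, rfl⟩ := twoCocycleClass_surjective _ z
        rw [ContinuousRep.twoZero_apply, cohomologyMap_twoCocycleClass, cohomologyMap_twoCocycleClass]
        exact congrArg (fun y => ιF (twoCocycleClass _ y)) (Subtype.ext (ContinuousMap.ext fun _ => rfl))
      rw [e1, ← cor_cohomologyMap_resH (galFixing F E) ρ (mu F (p ^ k)) φ 1 z, ← hιE_apply,
        ← ContinuousRep.twoZero_apply, hsurj]
      change lam (cor (galFixing F E) ρ 2 (resH (galFixing F E) ρ 2 z)) = _
      rw [cor_resH (galFixing F E) ρ 1 z, map_nsmul]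
    have hcfN : ∀ g, ρ.homRep (mu F (p ^ k)) g (c • fN) = c • fN := fun g => by rw [map_zsmul, hfN g]
    refine ⟨c • fN, hcfN, AddMonoidHom.ext fun z => ?_⟩
    rw [ContinuousRep.twoZero_zsmul ρ (mu F (p ^ k)) ιF c fN hfN hcfN z, key, ← natCast_zsmul, smul_smul]
    exact hc _
  have hle1 : Nat.card (continuousCohomology 2 ρ.toTopRep) ≤ Nat.card (ρ.homRep (mu F (p ^ k))).toTopRep.ρ.invariants := by
    rw [← Nat.card_addMonoidHom_zmod hH2n]
    refine Nat.card_le_card_of_surjective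
      (fun w : (ρ.homRep (mu F (p ^ k))).toTopRep.ρ.invariants => ρ.twoZero (mu F (p ^ k)) ιF w.1 w.2) fun lam => ?_
    obtain ⟨f, hf, h⟩ := surjF lam
    exact ⟨⟨f, hf⟩, h⟩
  -- (≥) the left kernel of `(M^D)^{Γ_F} × H²(F, M^{DD}) → ℤ/n` is trivial
  have hYp : IsPrimaryTorsion p (HomCarrier M (MuCarrier F (p ^ k))) := isPrimaryTorsion_homCarrier hpM
  have hYn : ∀ h : HomCarrier M (MuCarrier F (p ^ k)), (p ^ k) • h = 0 := fun h => HomCarrier.nsmul_eq_zero_of_left hM h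
  have hN₀Y : ∀ g ∈ N₀, ∀ h : HomCarrier M (MuCarrier F (p ^ k)),
      (ρ.homRep (mu F (p ^ k))).restrict (subgroupIncl (galFixing F E)) g h = h := fun g hg h =>
    (ContinuousRep.homRep_apply_eq_self_iff _ _ (g : absoluteGaloisGroup F) h).2 fun m => by
      rw [hN₀M g hg m, hN₀Ω g hg]
  have leftF : ∀ (w : HomCarrier M (MuCarrier F (p ^ k))) (hw : ∀ g, ρ.homRep (mu F (p ^ k)) g w = w),
      (∀ z, (ρ.homRep (mu F (p ^ k))).zeroTwo (mu F (p ^ k)) ιF w hw z = 0) → w = 0 := by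
    intro w hw hz
    have hwE : ∀ g : galFixing F E, (ρ.homRep (mu F (p ^ k))).restrict (subgroupIncl (galFixing F E)) g w = w := fun g => hw g
    refine zeroTwo_left_eq_zero_of_devissage ((mu F (p ^ k)).restrict (subgroupIncl (galFixing F E))) eΩ ιE N₀ hP hlineLeft h3
      _ ((ρ.homRep (mu F (p ^ k))).restrict (subgroupIncl (galFixing F E))) hYp hYn hN₀Y w hwE fun z' => ?_
    let eY := homRepRestrictIso (ρ.homRep (mu F (p ^ k))) (mu F (p ^ k)) (subgroupIncl (galFixing F E))
    obtain ⟨z'', rfl⟩ : ∃ z'', cohomologyMap eY.hom 2 z'' = z' :=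
      ⟨cohomologyMap eY.inv 2 z', cohomologyMap_inv_hom_apply eY.symm 2 z'⟩
    have e1 : ((ρ.homRep (mu F (p ^ k))).restrict (subgroupIncl (galFixing F E))).zeroTwo _ ιE w hwE (cohomologyMap eY.hom 2 z'') =
        ιF (cor (galFixing F E) (mu F (p ^ k)) 2 (cohomologyMap (resModHom (galFixing F E)
          (((ρ.homRep (mu F (p ^ k))).evalPairing (mu F (p ^ k))).leftHom w hw)) 2 z'')) := by
      obtain ⟨x, rfl⟩ := twoCocycleClass_surjective _ z''
      rw [ContinuousRep.zeroTwo_apply, hιE_apply, cohomologyMap_twoCocycleClass, cohomologyMap_twoCocycleClass,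
        cohomologyMap_twoCocycleClass]
      exact congrArg (fun y => ιF (cor (galFixing F E) (mu F (p ^ k)) 2 (twoCocycleClass _ y)))
        (Subtype.ext (ContinuousMap.ext fun _ => rfl))
    rw [e1, cor_cohomologyMap (galFixing F E) ((ρ.homRep (mu F (p ^ k))).homRep (mu F (p ^ k))) (mu F (p ^ k))
      (((ρ.homRep (mu F (p ^ k))).evalPairing (mu F (p ^ k))).leftHom w hw) 1 z'']
    exact hz _
  have hle2 : Nat.card (ρ.homRep (mu F (p ^ k))).toTopRep.ρ.invariants ≤ Nat.card (continuousCohomology 2 ρ.toTopRep) := by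
    have hYDn : ∀ z : continuousCohomology 2 ((ρ.homRep (mu F (p ^ k))).homRep (mu F (p ^ k))).toTopRep, (p ^ k) • z = 0 :=
      nsmul_continuousCohomology_two_eq_zero _ (p ^ k) fun h => HomCarrier.nsmul_eq_zero_of_left hYn h
    let eBD := ContinuousRep.biDualIso ρ (mu F (p ^ k)) eΩ hM
    haveI : Finite (continuousCohomology 2 ((ρ.homRep (mu F (p ^ k))).homRep (mu F (p ^ k))).toTopRep) :=
      Finite.of_equiv _ (continuousCohomologyEquivOfIso eBD 2)
    rw [natCard_continuousCohomology_eq_of_iso eBD 2, ← Nat.card_addMonoidHom_zmod hYDn]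
    haveI : Finite (continuousCohomology 2 ((ρ.homRep (mu F (p ^ k))).homRep (mu F (p ^ k))).toTopRep →+ ZMod (p ^ k)) :=
      finite_addMonoidHom_zmod _ _
    refine Nat.card_le_card_of_injective
      (fun w : (ρ.homRep (mu F (p ^ k))).toTopRep.ρ.invariants => (ρ.homRep (mu F (p ^ k))).zeroTwo (mu F (p ^ k)) ιF w.1 w.2)
      fun w₁ w₂ h => ?_
    have hww : ∀ g, ρ.homRep (mu F (p ^ k)) g (w₁.1 - w₂.1) = w₁.1 - w₂.1 := fun g => by
      rw [map_sub]
      exact congrArg₂ (· - ·) (w₁.2 g) (w₂.2 g)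
    have h0 : ∀ z, (ρ.homRep (mu F (p ^ k))).zeroTwo (mu F (p ^ k)) ιF (w₁.1 - w₂.1) hww z = 0 := fun z => by
      rw [ContinuousRep.zeroTwo_sub _ _ ιF w₁.1 w₂.1 w₁.2 w₂.2 hww z, sub_eq_zero]
      exact congrArg (fun φ : _ →+ ZMod (p ^ k) => φ z) h
    exact Subtype.ext (sub_eq_zero.1 (leftF _ hww h0))
  exact ⟨finF, le_antisymm hle1 hle2⟩

end Local

end Literature.NumberTheory.GaloisRepresentations

end
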